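import Summits.RiemannHypothesis.RiemannHypothesis.Theorems.SemilocalDeletionCliff
import Summits.RiemannHypothesis.RiemannHypothesis.Theorems.SemilocalDeletionCliffFalsifiers
import Summits.RiemannHypothesis.RiemannHypothesis.Theorems.HandoffSemilocalEnergy
import Summits.RiemannHypothesis.RiemannHypothesis.Theorems.HandoffSliver
import Literature.NumberTheory.LFunctions.WeilSemilocalNegative
import HarnessLib

/-!
# The SLIVER SANDWICH: changing the prime set moves the semi-local form by at most the weighted sliver masses

For finite sets of primes `S' ⊆ S`, a Weil test function `g` on the window `[−c, c]` and `2c < log (N+1)`, the two semi-local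
forms differ by the EXACT atom sum (§1, `quadratic_sub_eq_atomSum`)

  `Q_{S'}(g) − Q_S(g) = Σ_{n ≤ N} w_n·(k(log n) + k(−log n))`,  `w_n = Λ_S(n)/√n − Λ_{S'}(n)/√n ≥ 0`,  `k = g ⋆ g̃`,

(`w_n = Λ(n)/√n` exactly at the prime powers `n` that are `S`-smooth but not `S'`-smooth, `0` elsewhere).  The HANDOFF track's
sliver bound (`HandoffSliver.norm_weilConv_weilReflect_add_neg_le_sliver`) controls every atom by the mass of `g` on the two
SLIVERS of the window at mutual distance `log n`:  `|k(x) + k(−x)| ≤ sl_g(x) := ∫_{[x−c, c]}|g|² + ∫_{[−c, c−x]}|g|²`.  Hence (§2)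

* `re_quadratic_ge_sub_sliverSum` / `re_quadratic_le_add_sliverSum` / `abs_re_quadratic_sub_le_sliverSum` — **SLIVER SANDWICH**:
  `|Re Q_{S'}(g) − Re Q_S(g)| ≤ Σ_{n ≤ N} w_n·sl_g(log n)`  — no visibility hypothesis, every window, both directions;
* `weightedSliverMass_ge_deficit` — **CONFINEMENT**: for a unit `g` with constraint `P`,
  `Σ_n w_n·sl_g(log n) ≥ λ_min(S; c; P) − Re Q_{S'}(g)`: a test function of the SMALLER prime set whose Rayleigh quotient lies
  `D` below the undeleted bottom carries weighted sliver mass ≥ `D` at the deleted lags (atoms with `log n ≥ 2c` have empty slivers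
  and cannot help; an atom with `c ≤ log n < 2c` is paid only on two outer zones of width `2c − log n`);

and in the energy language (§3), using `sl_g(x) ≤ 2‖g‖₂²`:

* `semilocalGroundEnergy_ge_sub_two_mul_atomSum` / `…_le_add_two_mul_atomSum` / `abs_semilocalGroundEnergy_sub_le`:
  `|λ_min(S'; c; P) − λ_min(S; c; P)| ≤ 2·Σ_{n ≤ N} w_n` («twice the deleted visible mass»; every constraint `P`, every window).

Relation to the seat's other files: `SemilocalDeletionCliffConfinement` is the one-atom case (`S' = S∖p`, `c < log p`: one sliver
pair); `SemilocalDeletionSchurFloor`/`…GeneralFloor` replace the sliver masses by a Schur weight `φ` (sharper constants when the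
lags interlock, total mass instead of slivers); `SemilocalDeletionToeplitzConfinement` is the commensurate-lag refinement.
DATA (lineage E, HOME/cc-s2-1/gen13/ANATOMY-LAW.md): near-floor functions of deleted forms live on the slivers / full fibres —
the excess over the floor is 79–100 % «slack» of exactly this kind.  Nothing here bears on RH: statements about truncated forms.
-/

set_option linter.dupNamespace false

noncomputable section

open Complex Filter Set MeasureTheory
open scoped Real Topology ComplexConjugate

namespace Summit.RiemannHypothesis.RiemannHypothesis.Theorems.SemilocalDeletionSliverSandwich

open Literature.NumberTheory.LFunctions
open Summit.RiemannHypothesis.RiemannHypothesis.Theorems.SemilocalDeletionCliff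
open Summit.RiemannHypothesis.RiemannHypothesis.Theorems.HandoffSemilocalEnergy
open Summit.RiemannHypothesis.RiemannHypothesis.Theorems.Handoff

variable {g : ℝ → ℂ} {S S' : Finset ℕ} {c : ℝ} {N : ℕ}

/-! ## §1  Deleted weights and the exact atom sum -/

/-- The coefficients are monotone in the prime set: `S' ⊆ S ⇒ Λ_{S'}(n)/√n ≤ Λ_S(n)/√n`. -/
theorem coeff_le_of_subset (h : S' ⊆ S) (n : ℕ) : weilSemilocalCoeff S' n ≤ weilSemilocalCoeff S n := by
  by_cases h' : n.primeFactors ⊆ S'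
  · have hS : n.primeFactors ⊆ S := h'.trans h
    unfold weilSemilocalCoeff
    rw [if_pos h', if_pos hS]
  · have : weilSemilocalCoeff S' n = 0 := by unfold weilSemilocalCoeff; rw [if_neg h']
    rw [this]
    exact weilSemilocalCoeff_nonneg S n

/-- The deleted weight `w_n = Λ_S(n)/√n − Λ_{S'}(n)/√n` is nonnegative for `S' ⊆ S`. -/
theorem deletedWeight_nonneg (h : S' ⊆ S) (n : ℕ) : 0 ≤ weilSemilocalCoeff S n - weilSemilocalCoeff S' n :=
  sub_nonneg.2 (coeff_le_of_subset h n)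

/-- **Exact atom sum.** For `g ∈ C(c)` and `2c < log (N+1)` (any two finite sets `S, S'`):
`Q_{S'}(g) − Q_S(g) = Σ_{n ≤ N} (Λ_S(n) − Λ_{S'}(n)) n^{−1/2}·(k(log n) + k(−log n))`, `k = g ⋆ g̃`. -/
theorem quadratic_sub_eq_atomSum (hg : IsWeilTest g) (hsupp : tsupport g ⊆ Icc (-c) c)
    (hN : 2 * c < Real.log ((N : ℝ) + 1)) (S S' : Finset ℕ) :
    weilSemilocalQuadratic S' g - weilSemilocalQuadratic S g =
      ∑ n ∈ Finset.range (N + 1), (((weilSemilocalCoeff S n - weilSemilocalCoeff S' n : ℝ)) : ℂ) *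
        (weilConv g (weilReflect g) (Real.log n) + weilConv g (weilReflect g) (-Real.log n)) := by
  set k := weilConv g (weilReflect g) with hkdef
  have hk : IsWeilTest k := hg.weilConv hg.weilReflect
  have hks : tsupport k ⊆ Icc (-Real.log ((N : ℝ) + 1)) (Real.log ((N : ℝ) + 1)) :=
    (tsupport_weilConv_weilReflect_subset (a := c) hg.2 hsupp).trans (Icc_subset_Icc (by linarith) (by linarith))
  have hS := weilSemilocalPrimeTerm_eq_sum_of_tsupport_subset S hk.1.continuous N hks
  have hS' := weilSemilocalPrimeTerm_eq_sum_of_tsupport_subset S' hk.1.continuous N hks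
  have hdiff : weilSemilocalPrimeTerm S k - weilSemilocalPrimeTerm S' k =
      ∑ n ∈ Finset.range (N + 1), (((weilSemilocalCoeff S n - weilSemilocalCoeff S' n : ℝ)) : ℂ) *
        (k (Real.log n) + k (-Real.log n)) := by
    rw [hS, hS', ← Finset.sum_sub_distrib]
    refine Finset.sum_congr rfl fun n _ ↦ ?_
    push_cast
    ring
  unfold weilSemilocalQuadratic weilSemilocalFunctional
  rw [← hkdef]
  linear_combination hdiff

/-- Real part of the atom sum: `Re Q_{S'}(g) − Re Q_S(g) = Σ_{n ≤ N} w_n·Re(k(log n) + k(−log n))`. -/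
theorem re_quadratic_sub_eq_atomSum (hg : IsWeilTest g) (hsupp : tsupport g ⊆ Icc (-c) c)
    (hN : 2 * c < Real.log ((N : ℝ) + 1)) (S S' : Finset ℕ) :
    (weilSemilocalQuadratic S' g).re - (weilSemilocalQuadratic S g).re =
      ∑ n ∈ Finset.range (N + 1), (weilSemilocalCoeff S n - weilSemilocalCoeff S' n) *
        (weilConv g (weilReflect g) (Real.log n) + weilConv g (weilReflect g) (-Real.log n)).re := by
  have h := quadratic_sub_eq_atomSum hg hsupp hN S S'
  have := congrArg Complex.re h
  rw [Complex.sub_re, Complex.re_sum] at this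
  rw [this]
  refine Finset.sum_congr rfl fun n _ ↦ ?_
  rw [Complex.re_ofReal_mul]

/-! ## §2  The sliver sandwich -/

/-- **SLIVER FLOOR (general sub-family).** `S' ⊆ S`, `g ∈ C(c)`, `2c < log (N+1)`:
`Re Q_{S'}(g) ≥ Re Q_S(g) − Σ_{n ≤ N} w_n·(∫_{[log n − c, c]}|g|² + ∫_{[−c, c − log n]}|g|²)`. -/
theorem re_quadratic_ge_sub_sliverSum (hsub : S' ⊆ S) (hg : IsWeilTest g) (hsupp : tsupport g ⊆ Icc (-c) c)
    (hN : 2 * c < Real.log ((N : ℝ) + 1)) :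
    (weilSemilocalQuadratic S g).re - ∑ n ∈ Finset.range (N + 1), (weilSemilocalCoeff S n - weilSemilocalCoeff S' n) *
        ((∫ u in Icc (Real.log n - c) c, ‖g u‖ ^ 2) + ∫ u in Icc (-c) (c - Real.log n), ‖g u‖ ^ 2) ≤
      (weilSemilocalQuadratic S' g).re := by
  have h := re_quadratic_sub_eq_atomSum hg hsupp hN S S'
  have hterm : ∀ n ∈ Finset.range (N + 1),
      -((weilSemilocalCoeff S n - weilSemilocalCoeff S' n) *
        ((∫ u in Icc (Real.log n - c) c, ‖g u‖ ^ 2) + ∫ u in Icc (-c) (c - Real.log n), ‖g u‖ ^ 2)) ≤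
      (weilSemilocalCoeff S n - weilSemilocalCoeff S' n) *
        (weilConv g (weilReflect g) (Real.log n) + weilConv g (weilReflect g) (-Real.log n)).re := by
    intro n _
    have hw := deletedWeight_nonneg hsub n
    have hsl := norm_weilConv_weilReflect_add_neg_le_sliver hg hsupp (Real.log n)
    have hre := (abs_le.1 ((abs_re_le_norm _).trans hsl)).1
    nlinarith
  have hsum := Finset.sum_le_sum hterm
  rw [Finset.sum_neg_distrib] at hsum
  linarith

/-- **SLIVER CEILING (general sub-family).** `S' ⊆ S`, `g ∈ C(c)`, `2c < log (N+1)`: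
`Re Q_{S'}(g) ≤ Re Q_S(g) + Σ_{n ≤ N} w_n·(∫_{[log n − c, c]}|g|² + ∫_{[−c, c − log n]}|g|²)`. -/
theorem re_quadratic_le_add_sliverSum (hsub : S' ⊆ S) (hg : IsWeilTest g) (hsupp : tsupport g ⊆ Icc (-c) c)
    (hN : 2 * c < Real.log ((N : ℝ) + 1)) :
    (weilSemilocalQuadratic S' g).re ≤ (weilSemilocalQuadratic S g).re +
      ∑ n ∈ Finset.range (N + 1), (weilSemilocalCoeff S n - weilSemilocalCoeff S' n) *
        ((∫ u in Icc (Real.log n - c) c, ‖g u‖ ^ 2) + ∫ u in Icc (-c) (c - Real.log n), ‖g u‖ ^ 2) := by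
  have h := re_quadratic_sub_eq_atomSum hg hsupp hN S S'
  have hterm : ∀ n ∈ Finset.range (N + 1),
      (weilSemilocalCoeff S n - weilSemilocalCoeff S' n) *
        (weilConv g (weilReflect g) (Real.log n) + weilConv g (weilReflect g) (-Real.log n)).re ≤
      (weilSemilocalCoeff S n - weilSemilocalCoeff S' n) *
        ((∫ u in Icc (Real.log n - c) c, ‖g u‖ ^ 2) + ∫ u in Icc (-c) (c - Real.log n), ‖g u‖ ^ 2) := by
    intro n _
    have hw := deletedWeight_nonneg hsub n
    have hsl := norm_weilConv_weilReflect_add_neg_le_sliver hg hsupp (Real.log n)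
    have hre := (abs_le.1 ((abs_re_le_norm _).trans hsl)).2
    nlinarith
  have hsum := Finset.sum_le_sum hterm
  linarith

/-- **SLIVER SANDWICH.** `|Re Q_{S'}(g) − Re Q_S(g)| ≤ Σ_{n ≤ N} w_n·sl_g(log n)` for `S' ⊆ S`, `g ∈ C(c)`, `2c < log (N+1)`. -/
theorem abs_re_quadratic_sub_le_sliverSum (hsub : S' ⊆ S) (hg : IsWeilTest g) (hsupp : tsupport g ⊆ Icc (-c) c)
    (hN : 2 * c < Real.log ((N : ℝ) + 1)) :
    |(weilSemilocalQuadratic S' g).re - (weilSemilocalQuadratic S g).re| ≤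
      ∑ n ∈ Finset.range (N + 1), (weilSemilocalCoeff S n - weilSemilocalCoeff S' n) *
        ((∫ u in Icc (Real.log n - c) c, ‖g u‖ ^ 2) + ∫ u in Icc (-c) (c - Real.log n), ‖g u‖ ^ 2) := by
  have h1 := re_quadratic_ge_sub_sliverSum hsub hg hsupp hN
  have h2 := re_quadratic_le_add_sliverSum hsub hg hsupp hN
  exact abs_le.2 ⟨by linarith, by linarith⟩

variable {P : (ℝ → ℂ) → Prop}

/-- **CONFINEMENT (general sub-family).** For a unit `g ∈ C(c)` with `P g`, `S' ⊆ S`, `2c < log (N+1)`: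
`Σ_{n ≤ N} w_n·sl_g(log n) ≥ λ_min(S; c; P) − Re Q_{S'}(g)` — the deficit of a test function of the smaller prime set below the
larger set's bottom is carried by its sliver masses at the deleted lags. -/
theorem weightedSliverMass_ge_deficit (hsub : S' ⊆ S) (hg : IsWeilTest g) (hsupp : tsupport g ⊆ Icc (-c) c)
    (hN : 2 * c < Real.log ((N : ℝ) + 1)) (hPg : P g) (hn : ∫ u : ℝ, ‖g u‖ ^ 2 = 1) :
    semilocalGroundEnergy S P c - (weilSemilocalQuadratic S' g).re ≤
      ∑ n ∈ Finset.range (N + 1), (weilSemilocalCoeff S n - weilSemilocalCoeff S' n) *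
        ((∫ u in Icc (Real.log n - c) c, ‖g u‖ ^ 2) + ∫ u in Icc (-c) (c - Real.log n), ‖g u‖ ^ 2) := by
  have h := re_quadratic_ge_sub_sliverSum hsub hg hsupp hN
  have h2 := semilocalGroundEnergy_le_re (S := S) hg hsupp hPg hn
  linarith

/-! ## §3  Energy language: twice the deleted visible mass -/

/-- A sliver pair never carries more than twice the total mass. -/
theorem sliverMass_le_two_mul (hg : IsWeilTest g) (x : ℝ) :
    (∫ u in Icc (x - c) c, ‖g u‖ ^ 2) + (∫ u in Icc (-c) (c - x), ‖g u‖ ^ 2) ≤ 2 * ∫ u : ℝ, ‖g u‖ ^ 2 := by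
  have hi := hg.integrable_norm_sq
  have h1 : (∫ u in Icc (x - c) c, ‖g u‖ ^ 2) ≤ ∫ u : ℝ, ‖g u‖ ^ 2 :=
    setIntegral_le_integral hi (Eventually.of_forall fun u ↦ by positivity)
  have h2 : (∫ u in Icc (-c) (c - x), ‖g u‖ ^ 2) ≤ ∫ u : ℝ, ‖g u‖ ^ 2 :=
    setIntegral_le_integral hi (Eventually.of_forall fun u ↦ by positivity)
  linarith

/-- **Rayleigh form with total mass**: `Re Q_{S'}(g) ≥ Re Q_S(g) − 2(Σ_n w_n)·‖g‖₂²` (`S' ⊆ S`, `g ∈ C(c)`, `2c < log (N+1)`). -/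
theorem re_quadratic_ge_sub_two_mul_atomSum (hsub : S' ⊆ S) (hg : IsWeilTest g) (hsupp : tsupport g ⊆ Icc (-c) c)
    (hN : 2 * c < Real.log ((N : ℝ) + 1)) :
    (weilSemilocalQuadratic S g).re -
        2 * (∑ n ∈ Finset.range (N + 1), (weilSemilocalCoeff S n - weilSemilocalCoeff S' n)) * ∫ u : ℝ, ‖g u‖ ^ 2 ≤
      (weilSemilocalQuadratic S' g).re := by
  have h := re_quadratic_ge_sub_sliverSum hsub hg hsupp hN
  have hterm : ∀ n ∈ Finset.range (N + 1),
      (weilSemilocalCoeff S n - weilSemilocalCoeff S' n) *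
        ((∫ u in Icc (Real.log n - c) c, ‖g u‖ ^ 2) + ∫ u in Icc (-c) (c - Real.log n), ‖g u‖ ^ 2) ≤
      (weilSemilocalCoeff S n - weilSemilocalCoeff S' n) * (2 * ∫ u : ℝ, ‖g u‖ ^ 2) := fun n _ ↦
    mul_le_mul_of_nonneg_left (sliverMass_le_two_mul hg _) (deletedWeight_nonneg hsub n)
  have hsum := Finset.sum_le_sum hterm
  rw [← Finset.sum_mul] at hsum
  linarith

/-- Ceiling with total mass: `Re Q_{S'}(g) ≤ Re Q_S(g) + 2(Σ_n w_n)·‖g‖₂²`. -/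
theorem re_quadratic_le_add_two_mul_atomSum (hsub : S' ⊆ S) (hg : IsWeilTest g) (hsupp : tsupport g ⊆ Icc (-c) c)
    (hN : 2 * c < Real.log ((N : ℝ) + 1)) :
    (weilSemilocalQuadratic S' g).re ≤ (weilSemilocalQuadratic S g).re +
      2 * (∑ n ∈ Finset.range (N + 1), (weilSemilocalCoeff S n - weilSemilocalCoeff S' n)) * ∫ u : ℝ, ‖g u‖ ^ 2 := by
  have h := re_quadratic_le_add_sliverSum hsub hg hsupp hN
  have hterm : ∀ n ∈ Finset.range (N + 1),
      (weilSemilocalCoeff S n - weilSemilocalCoeff S' n) *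
        ((∫ u in Icc (Real.log n - c) c, ‖g u‖ ^ 2) + ∫ u in Icc (-c) (c - Real.log n), ‖g u‖ ^ 2) ≤
      (weilSemilocalCoeff S n - weilSemilocalCoeff S' n) * (2 * ∫ u : ℝ, ‖g u‖ ^ 2) := fun n _ ↦
    mul_le_mul_of_nonneg_left (sliverMass_le_two_mul hg _) (deletedWeight_nonneg hsub n)
  have hsum := Finset.sum_le_sum hterm
  rw [← Finset.sum_mul] at hsum
  linarith

/-- **Energy floor**: `λ_min(S'; c; P) ≥ λ_min(S; c; P) − 2·Σ_{n ≤ N} w_n` (`S' ⊆ S`, `2c < log (N+1)`, any constraint `P`). -/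
theorem semilocalGroundEnergy_ge_sub_two_mul_atomSum (hsub : S' ⊆ S) (hN : 2 * c < Real.log ((N : ℝ) + 1)) :
    semilocalGroundEnergy S P c - 2 * ∑ n ∈ Finset.range (N + 1), (weilSemilocalCoeff S n - weilSemilocalCoeff S' n) ≤
      semilocalGroundEnergy S' P c := by
  rcases (semilocalSphereValues S' P c).eq_empty_or_nonempty with he | hne
  · have he' : semilocalSphereValues S P c = ∅ := by
      rcases (semilocalSphereValues S P c).eq_empty_or_nonempty with h0 | h0
      · exact h0
      · have := (semilocalSphereValues_nonempty_iff S P c).1 h0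
        rw [← semilocalSphereValues_nonempty_iff S' P c, he] at this
        exact absurd this Set.not_nonempty_empty
    have hw : 0 ≤ ∑ n ∈ Finset.range (N + 1), (weilSemilocalCoeff S n - weilSemilocalCoeff S' n) :=
      Finset.sum_nonneg fun n _ ↦ deletedWeight_nonneg hsub n
    rw [semilocalGroundEnergy, semilocalGroundEnergy, he, he', Real.sInf_empty]
    linarith
  · refine le_semilocalGroundEnergy hne fun g hg hs hPg hn ↦ ?_
    have h1 := re_quadratic_ge_sub_two_mul_atomSum hsub hg hs hN
    have h2 := semilocalGroundEnergy_le_re (S := S) hg hs hPg hn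
    rw [hn, mul_one] at h1
    linarith

/-- **Energy ceiling**: `λ_min(S'; c; P) ≤ λ_min(S; c; P) + 2·Σ_{n ≤ N} w_n` (`S' ⊆ S`, `2c < log (N+1)`, any constraint `P`). -/
theorem semilocalGroundEnergy_le_add_two_mul_atomSum (hsub : S' ⊆ S) (hN : 2 * c < Real.log ((N : ℝ) + 1)) :
    semilocalGroundEnergy S' P c ≤
      semilocalGroundEnergy S P c + 2 * ∑ n ∈ Finset.range (N + 1), (weilSemilocalCoeff S n - weilSemilocalCoeff S' n) := by
  rcases (semilocalSphereValues S P c).eq_empty_or_nonempty with he | hne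
  · have he' : semilocalSphereValues S' P c = ∅ := by
      rcases (semilocalSphereValues S' P c).eq_empty_or_nonempty with h0 | h0
      · exact h0
      · have := (semilocalSphereValues_nonempty_iff S' P c).1 h0
        rw [← semilocalSphereValues_nonempty_iff S P c, he] at this
        exact absurd this Set.not_nonempty_empty
    have hw : 0 ≤ ∑ n ∈ Finset.range (N + 1), (weilSemilocalCoeff S n - weilSemilocalCoeff S' n) :=
      Finset.sum_nonneg fun n _ ↦ deletedWeight_nonneg hsub n
    rw [semilocalGroundEnergy, semilocalGroundEnergy, he, he', Real.sInf_empty]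
    linarith
  · have key : semilocalGroundEnergy S' P c -
        2 * ∑ n ∈ Finset.range (N + 1), (weilSemilocalCoeff S n - weilSemilocalCoeff S' n) ≤
        semilocalGroundEnergy S P c := by
      refine le_semilocalGroundEnergy hne fun g hg hs hPg hn ↦ ?_
      have h1 := re_quadratic_le_add_two_mul_atomSum hsub hg hs hN
      have h2 := semilocalGroundEnergy_le_re (S := S') hg hs hPg hn
      rw [hn, mul_one] at h1
      linarith
    linarith

/-- **LIPSCHITZ IN THE PRIME SET (visible-mass modulus).** `|λ_min(S'; c; P) − λ_min(S; c; P)| ≤ 2·Σ_{n ≤ N} w_n` for `S' ⊆ S`,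
`2c < log (N+1)`: the semi-local bottom moves by at most twice the deleted visible mass, on every window and in every sector. -/
theorem abs_semilocalGroundEnergy_sub_le (hsub : S' ⊆ S) (hN : 2 * c < Real.log ((N : ℝ) + 1)) :
    |semilocalGroundEnergy S' P c - semilocalGroundEnergy S P c| ≤
      2 * ∑ n ∈ Finset.range (N + 1), (weilSemilocalCoeff S n - weilSemilocalCoeff S' n) := by
  have h1 := semilocalGroundEnergy_ge_sub_two_mul_atomSum (P := P) hsub hN
  have h2 := semilocalGroundEnergy_le_add_two_mul_atomSum (P := P) hsub hN
  exact abs_le.2 ⟨by linarith, by linarith⟩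

/-! ## §4  RH-facing form (appended, cc-s2-1 gen13): SLIVER FALSIFIERS -/

open Summit.RiemannHypothesis.RiemannHypothesis.Theorems.SemilocalDeletionCliffFalsifiers in
/-- **RH ⇒ the deficit of every semi-local form is carried by slivers.** If `S` contains the prime factors of every prime power
`n ≤ N`, `0 < c`, `2c < log (N+1)` and RH holds, then for every `S' ⊆ S` and every `g ∈ C(c)`:
`Re Q_{S'}(g) ≥ −Σ_{n ≤ N} (Λ_S(n) − Λ_{S'}(n)) n^{−1/2}·(∫_{[log n − c, c]}|g|² + ∫_{[−c, c − log n]}|g|²)` — a semi-local form can only be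
negative on a window through mass its test function places on the slivers of the MISSING visible atoms. -/
theorem re_quadratic_ge_neg_sliverSum_of_riemannHypothesis (hRH : Summit.RiemannHypothesis)
    (hS : ∀ n ≤ N, IsPrimePow n → n.primeFactors ⊆ S) (hc : 0 < c) (hN : 2 * c < Real.log ((N : ℝ) + 1))
    (hsub : S' ⊆ S) (hg : IsWeilTest g) (hsupp : tsupport g ⊆ Icc (-c) c) :
    -∑ n ∈ Finset.range (N + 1), (weilSemilocalCoeff S n - weilSemilocalCoeff S' n) *
        ((∫ u in Icc (Real.log n - c) c, ‖g u‖ ^ 2) + ∫ u in Icc (-c) (c - Real.log n), ‖g u‖ ^ 2) ≤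
      (weilSemilocalQuadratic S' g).re := by
  have hpos := weilSemilocalPositivityOn_of_riemannHypothesis hRH hS hc (by linarith)
  have h0 : 0 ≤ (weilSemilocalQuadratic S g).re := hpos g hg hsupp
  have h1 := re_quadratic_ge_sub_sliverSum hsub hg hsupp hN
  linarith

open Summit.RiemannHypothesis.RiemannHypothesis.Theorems.SemilocalDeletionCliffFalsifiers in
/-- **SLIVER FALSIFIER (one test function).** With `S ⊇ {prime factors of prime powers ≤ N}`, `0 < c`, `2c < log (N+1)`, `S' ⊆ S`:
a Weil test function `g ∈ C(c)` with `Re Q_{S'}(g) < −Σ_{n ≤ N} w_n·sl_g(log n)` REFUTES RH.  Sharper than the mass falsifier of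
`SemilocalDeletionCliffFalsifiers` (which charges `(Σ_{p∈D} log p/√p)·‖g‖₂²`): only the sliver masses count, and every visible atom
(all prime powers, any sub-family) is allowed. -/
theorem not_riemannHypothesis_of_re_lt_neg_sliverSum (hS : ∀ n ≤ N, IsPrimePow n → n.primeFactors ⊆ S) (hc : 0 < c)
    (hN : 2 * c < Real.log ((N : ℝ) + 1)) (hsub : S' ⊆ S) (hg : IsWeilTest g) (hsupp : tsupport g ⊆ Icc (-c) c)
    (hlt : (weilSemilocalQuadratic S' g).re <
      -∑ n ∈ Finset.range (N + 1), (weilSemilocalCoeff S n - weilSemilocalCoeff S' n) *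
        ((∫ u in Icc (Real.log n - c) c, ‖g u‖ ^ 2) + ∫ u in Icc (-c) (c - Real.log n), ‖g u‖ ^ 2)) :
    ¬ Summit.RiemannHypothesis := by
  intro hRH
  have h := re_quadratic_ge_neg_sliverSum_of_riemannHypothesis hRH hS hc hN hsub hg hsupp
  linarith

open Summit.RiemannHypothesis.RiemannHypothesis.Theorems.SemilocalDeletionCliffFalsifiers in
/-- **RH ⇒ visible-mass floor for every sub-family bottom**: `λ_min(S'; c; P) ≥ −2·Σ_{n ≤ N} (Λ_S(n) − Λ_{S'}(n))/√n` for
`S' ⊆ S ⊇ {prime factors of prime powers ≤ N}`, `0 < c`, `2c < log (N+1)`, and any constraint `P` stable under positive scaling.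
Contrapositive = an energy-language falsifier: a certified sub-family bottom below minus twice its missing visible mass refutes RH. -/
theorem semilocalGroundEnergy_ge_neg_two_mul_atomSum_of_riemannHypothesis (hRH : Summit.RiemannHypothesis)
    (hS : ∀ n ≤ N, IsPrimePow n → n.primeFactors ⊆ S) (hc : 0 < c) (hN : 2 * c < Real.log ((N : ℝ) + 1)) (hsub : S' ⊆ S)
    (hP : ∀ (a : ℝ) (g : ℝ → ℂ), 0 < a → P g → P fun t ↦ (a : ℂ) * g t) :
    -(2 * ∑ n ∈ Finset.range (N + 1), (weilSemilocalCoeff S n - weilSemilocalCoeff S' n)) ≤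
      semilocalGroundEnergy S' P c := by
  have hpos := weilSemilocalPositivityOn_of_riemannHypothesis hRH hS hc (by linarith)
  have h0 : 0 ≤ semilocalGroundEnergy S P c := (semilocalGroundEnergy_nonneg_iff hP).2 fun g hg hs _ ↦ hpos g hg hs
  have h1 := semilocalGroundEnergy_ge_sub_two_mul_atomSum (P := P) hsub hN
  linarith

/-! ## §5  Any two prime sets (appended, cc-s2-1 gen13): the visible-mass modulus through `S ∩ S'` -/

/-- **VISIBLE-MASS MODULUS for arbitrary finite prime sets.** For any `S, S'`, `2c < log (N+1)` and any constraint `P`: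
`|λ_min(S'; c; P) − λ_min(S; c; P)| ≤ 2·Σ_{n ≤ N} (Λ_S(n) − Λ_{S∩S'}(n))/√n + 2·Σ_{n ≤ N} (Λ_{S'}(n) − Λ_{S∩S'}(n))/√n`
(pass through the common part `S ∩ S'`; each term is twice the visible mass of the atoms one set has and the other lacks). -/
theorem abs_semilocalGroundEnergy_sub_le_of_inter (S S' : Finset ℕ) (hN : 2 * c < Real.log ((N : ℝ) + 1)) :
    |semilocalGroundEnergy S' P c - semilocalGroundEnergy S P c| ≤
      2 * ∑ n ∈ Finset.range (N + 1), (weilSemilocalCoeff S n - weilSemilocalCoeff (S ∩ S') n) +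
        2 * ∑ n ∈ Finset.range (N + 1), (weilSemilocalCoeff S' n - weilSemilocalCoeff (S ∩ S') n) := by
  have h1 := abs_semilocalGroundEnergy_sub_le (P := P) (Finset.inter_subset_left (s₁ := S) (s₂ := S')) hN
  have h2 := abs_semilocalGroundEnergy_sub_le (P := P) (Finset.inter_subset_right (s₁ := S) (s₂ := S')) hN
  rw [abs_le] at h1 h2 ⊢
  constructor <;> linarith [h1.1, h1.2, h2.1, h2.2]

/-! ## §6  THRESHOLD TRANSFER between prime sets (appended, cc-s2-1 gen13) -/

open Summit.RiemannHypothesis.RiemannHypothesis.Theorems.MotivicDoor.SemilocalThreshold in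
/-- **Positivity transfer.** If on the window `C(c)` (`2c < log (N+1)`) the unconstrained bottom of the `S`-form exceeds twice the
visible mass of the atoms on which `S` and `S'` differ, `λ_min(S; c) ≥ 2·Σ_{n≤N}(Λ_S − Λ_{S∩S'})(n)/√n + 2·Σ_{n≤N}(Λ_{S'} − Λ_{S∩S'})(n)/√n`,
then the `S'`-form is nonnegative on `C(c)`. -/
theorem weilSemilocalPositivityOn_of_energy_ge_visibleMass (S S' : Finset ℕ) (hN : 2 * c < Real.log ((N : ℝ) + 1))
    (h : 2 * ∑ n ∈ Finset.range (N + 1), (weilSemilocalCoeff S n - weilSemilocalCoeff (S ∩ S') n) +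
        2 * ∑ n ∈ Finset.range (N + 1), (weilSemilocalCoeff S' n - weilSemilocalCoeff (S ∩ S') n) ≤
      semilocalGroundEnergy S (fun _ ↦ True) c) :
    WeilSemilocalPositivityOn S' c := by
  have hmod := abs_semilocalGroundEnergy_sub_le_of_inter (P := fun _ ↦ True) S S' hN
  have h0 : 0 ≤ semilocalGroundEnergy S' (fun _ ↦ True) c := by
    have := (abs_le.1 hmod).1
    linarith
  exact fun g hg hs ↦ ((semilocalGroundEnergy_nonneg_iff (S := S') (a := c) fun _ _ _ _ ↦ trivial).1 h0) g hg hs trivial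

open Summit.RiemannHypothesis.RiemannHypothesis.Theorems.MotivicDoor.SemilocalThreshold in
/-- **THRESHOLD TRANSFER.** Under the same hypothesis, `c ≤ a*(S')` (`a*(S') = weilSemilocalThreshold S'`, the semi-local threshold of
MotivicDoorSemilocalThreshold): a window on which one prime set's bottom clears twice the visible mass of the symmetric difference lies
below the threshold of the other set.  Contrapositive: just beyond the threshold of `S'`, EVERY other finite set's bottom is smaller
than twice the visible mass separating it from `S'` — thresholds of different prime sets can only differ inside these bands. -/
theorem le_weilSemilocalThreshold_of_energy_ge_visibleMass (S S' : Finset ℕ) (hN : 2 * c < Real.log ((N : ℝ) + 1))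
    (h : 2 * ∑ n ∈ Finset.range (N + 1), (weilSemilocalCoeff S n - weilSemilocalCoeff (S ∩ S') n) +
        2 * ∑ n ∈ Finset.range (N + 1), (weilSemilocalCoeff S' n - weilSemilocalCoeff (S ∩ S') n) ≤
      semilocalGroundEnergy S (fun _ ↦ True) c) :
    c ≤ weilSemilocalThreshold S' :=
  le_weilSemilocalThreshold (weilSemilocalPositivityOn_of_energy_ge_visibleMass S S' hN h)

open Summit.RiemannHypothesis.RiemannHypothesis.Theorems.MotivicDoor.SemilocalThreshold in
/-- **Beyond a threshold every bottom is small.** If `a*(S') < c` and `2c < log (N+1)` then for every finite `S`: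
`λ_min(S; c) < 2·Σ_{n≤N}(Λ_S − Λ_{S∩S'})(n)/√n + 2·Σ_{n≤N}(Λ_{S'} − Λ_{S∩S'})(n)/√n`. -/
theorem semilocalGroundEnergy_lt_visibleMass_of_weilSemilocalThreshold_lt (S S' : Finset ℕ)
    (hN : 2 * c < Real.log ((N : ℝ) + 1)) (hc : weilSemilocalThreshold S' < c) :
    semilocalGroundEnergy S (fun _ ↦ True) c <
      2 * ∑ n ∈ Finset.range (N + 1), (weilSemilocalCoeff S n - weilSemilocalCoeff (S ∩ S') n) +
        2 * ∑ n ∈ Finset.range (N + 1), (weilSemilocalCoeff S' n - weilSemilocalCoeff (S ∩ S') n) := by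
  by_contra h
  push Not at h
  have := le_weilSemilocalThreshold_of_energy_ge_visibleMass S S' hN h
  linarith

end Summit.RiemannHypothesis.RiemannHypothesis.Theorems.SemilocalDeletionSliverSandwich

end
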